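import Summits.QuantumAdvantage.QuantumAdvantage.Theorems.CharDialGammaDialA
import Summits.QuantumAdvantage.QuantumAdvantage.Theorems.CharDialGammaDialD

/-!
# CharDialGammaDialE — TREE PART E of the decomp-qadv lens-5 g32 node «GammaDial» on `CharDial.FrobStructureLawOdd`
# (stmt-QuantumAdvantage-27205): §7 the γ-dial is symmetric under `γ ↦ −γ` (complement `f`: `tabLawAt_neg`), so only the sectors
# `γ ∉ {0, ±1, ±2}` remain (`tabLaw_of_sectors`); §8 ★★ THE BASE RANGE `p = 5` IS DECIDED — `tabLaw_five : ∀ L, TabLaw 5 3 L`,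
# `tabAt_five`, `exchCoreAt_five`, `islandAt_five`, ★★★ `lawAt_five` (LAW 2½ AT `p = 5`: `∃ J₀, ∀ n f, HasDegF 5 f 4 → NormalForm 5 f J₀`);
# BRIDGE `target_iff_tabFrom7 : FrobStructureLawOdd ↔ ∀ p ≥ 7 prime, TabAt p`; RESIDUAL `SectorRes p` with
# `tabAt_iff_sectorRes` and ★★★ `target_iff_sectorResFrom7 : FrobStructureLawOdd ↔ ∀ p ≥ 7 prime, SectorRes p`;
# first instance `tabAt_seven_of_sector_three` (the sectors `γ = ±3` decide piece «Tab» at `7`).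

Verbatim `section Complement` and `section Five` of the node file (namespace `Theorems.GammaDial`); definition `SectorRes`
(plain `def`, no instances, no notation); no `sorry`.
-/

set_option autoImplicit false
set_option linter.dupNamespace false

namespace Summit.QuantumAdvantage.QuantumAdvantage.Theorems.GammaDial

open Finset
open Summit.QuantumAdvantage.AdviceFreeQNC0
open Literature.Computability.MetaComplexity Literature.Computability.MetaComplexity.Smolensky
open Summit.QuantumAdvantage.QuantumAdvantage.Theorems.IslandDial (Relevant Exch TopConst NormalForm ExchCoreAt ExchCoreOdd IslandAt
  IslandOdd exchCoreOdd_of_target islandOdd_of_target exch_weight_form)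
open Summit.QuantumAdvantage.QuantumAdvantage.Theorems.TableDial (TabLaw TabAt TabOdd tabLaw_all_of_core tabAt_iff_all tabOdd_of_target)
open Summit.QuantumAdvantage.QuantumAdvantage.Theorems.StrataDial (SwapInv exchCoreAt_iff_tabAt chi chi_slice chi_eq_zero_of_card
  chi_eq_zero_of_not_subset comp_swap_eq_self)

/-! ### §7 Complement symmetry `γ ↦ −γ` of the dial -/

section Complement

variable {p : ℕ} [hp : Fact p.Prime] {n : ℕ} {f : (Fin n → Bool) → Bool}

/-- `1_{¬f} = 1 − 1_f` (as `x_∅ − 1_f`). -/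
theorem indR_bnot : SubLog.indR (ZMod p) (fun u => !f u) = mono (ZMod p) ∅ - SubLog.indR (ZMod p) f := by
  funext u
  rw [Pi.sub_apply, mono_empty, Pi.one_apply]
  unfold SubLog.indR
  cases h : f u <;> simp [h]

/-- Complementation preserves the `𝔽_p`-degree. -/
theorem hasDegF_bnot {d : ℕ} (hf : HasDegF p f d) : HasDegF p (fun u => !f u) d := by
  rw [SubLog.hasDegF_iff_indR] at hf ⊢
  rw [indR_bnot]
  exact Submodule.sub_mem _ (mono_mem_lowDeg (by simp)) hf

/-- Complementation negates every Möbius stratum above `∅`. -/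
theorem moeb_indR_bnot (T : Finset (Fin n)) (hT : T.Nonempty) :
    SubLog.moeb (SubLog.indR (ZMod p) (fun u => !f u)) T = -SubLog.moeb (SubLog.indR (ZMod p) f) T := by
  rw [indR_bnot, SubLog.moeb_sub, SubLog.moeb_mono, if_neg (fun h => hT.ne_empty h.symm), zero_sub]

/-- Complementation flips the sign of the constant top stratum. -/
theorem topConst_bnot {X : Finset (Fin n)} {γ : ZMod p} (htop : TopConst p f X γ) : TopConst p (fun u => !f u) X (-γ) := by
  intro T hTX hTc
  have hne : T.Nonempty := Finset.card_pos.1 (by rw [hTc]; have := hp.out.two_le; omega)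
  rw [moeb_indR_bnot T hne, htop T hTX hTc]

/-- Complementation preserves exchangeability. -/
theorem exch_bnot_iff {Y : Finset (Fin n)} : Exch (fun u => !f u) Y ↔ Exch f Y := by
  constructor
  · intro h i hi j hj u
    have := h i hi j hj u
    simpa using this
  · intro h i hi j hj u
    show (!f (u ∘ Equiv.swap i j)) = !f u
    rw [h i hi j hj u]

/-- **The dial is symmetric under `γ ↦ −γ`** (complement the function). -/
theorem tabLawAt_neg {γ : ZMod p} {K L : ℕ} (h : TabLawAt p γ K L) : TabLawAt p (-γ) K L := by
  intro n g X R hRX hR hXR hdep hg htop hex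
  have hdep' : DependsOn (fun u => !g u) (↑X : Set (Fin n)) := fun x y hxy => by
    show (!g x) = !g y
    rw [hdep hxy]
  have htop' : TopConst p (fun u => !g u) X γ := by
    have := topConst_bnot htop
    rwa [neg_neg] at this
  obtain ⟨Y, hYX, hc, hY⟩ := h n (fun u => !g u) X R hRX hR hXR hdep' (hasDegF_bnot hg) htop' (exch_bnot_iff.2 hex)
  exact ⟨Y, hYX, hc, exch_bnot_iff.1 hY⟩

/-- **Reading of §5–§7 for every odd prime**: only the sectors `γ ∉ {0, ±1, ±2}` of the dial remain, and the
budget is at least `p − 2`. -/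
theorem tabLaw_of_sectors (p : ℕ) [hp : Fact p.Prime] (hp2 : p ≠ 2) {K L : ℕ} (hK : p - 2 ≤ K)
    (h : ∀ γ : ZMod p, γ ≠ 0 → γ ≠ 1 → γ ≠ -1 → γ ≠ 2 → γ ≠ -2 → TabLawAt p γ K L) : TabLaw p K L := by
  rw [tabLaw_iff_sectors]
  intro γ hγ
  have h1 : TabLawAt p 1 K L := tabLawAt_mono_K (Nat.zero_le _) (tabLawAt_one p hp2 L)
  have h2 : TabLawAt p 2 K L := tabLawAt_mono_K hK (tabLawAt_two p hp2 L)
  by_cases e1 : γ = 1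
  · rw [e1]; exact h1
  by_cases e1' : γ = -1
  · rw [e1']; exact tabLawAt_neg h1
  by_cases e2 : γ = 2
  · rw [e2]; exact h2
  by_cases e2' : γ = -2
  · rw [e2']; exact tabLawAt_neg h2
  exact h γ hγ e1 e1' e2 e2'

end Complement

/-! ### §8 Assembly: the table law, the exchangeable core and LAW 2½ AT `p = 5` (kernel-checked, no residual);
the target ⟺ the table law from `7` on ⟺ the sectors `γ ∉ {0, ±1, ±2}` from `7` on -/

section Five

/-- `𝔽₅^× = {±1, ±2}`. -/
theorem units_five : ∀ δ : ZMod 5, δ ≠ 0 → δ ≠ 1 → δ ≠ -1 → δ ≠ 2 → δ ≠ -2 → False := by decide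

/-- `𝔽₇^× = {±1, ±2, ±3}`. -/
theorem units_seven : ∀ δ : ZMod 7, δ ≠ 0 → δ ≠ 1 → δ ≠ -1 → δ ≠ 2 → δ ≠ -2 → δ = 3 ∨ δ = -3 := by decide

/-- **THE TABLE LAW AT `p = 5`** (budget `3 = p − 2`, every co-size `L`): `𝔽₅^× = {1, 2, −2, −1}` is covered by the
sectors of §5–§7. -/
theorem tabLaw_five [Fact (Nat.Prime 5)] (L : ℕ) : TabLaw 5 3 L :=
  tabLaw_of_sectors 5 (by norm_num) (by norm_num) fun γ h0 h1 h1' h2 h2' =>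
    (units_five γ h0 h1 h1' h2 h2').elim

/-- Piece «Tab» at `p = 5`. -/
theorem tabAt_five [Fact (Nat.Prime 5)] : TabAt 5 := ⟨3, tabLaw_five _⟩

/-- Piece E (the exchangeable core) at `p = 5`. -/
theorem exchCoreAt_five [Fact (Nat.Prime 5)] : ExchCoreAt 5 := (exchCoreAt_iff_tabAt 5).2 tabAt_five

/-- Piece I (the island bound) at `p = 5`. -/
theorem islandAt_five [Fact (Nat.Prime 5)] : IslandAt 5 := islandAt_of_tabAt 5 tabAt_five

/-- ★ **LAW 2½ AT `p = 5`**: every Boolean `f` of `𝔽₅`-degree `≤ 4` is a junta-indexed function of one linear form,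
`f(u) = h(u_J, Σ aᵢuᵢ)` with `|J| ≤ J₀` for an absolute `J₀` — the `p = 5` conjunct of the target, PROVED. -/
theorem lawAt_five [Fact (Nat.Prime 5)] :
    ∃ J₀ : ℕ, ∀ (n : ℕ) (f : (Fin n → Bool) → Bool), HasDegF 5 f (5 - 1) → NormalForm 5 f J₀ :=
  lawAt_of_tabAt 5 tabAt_five

/-- ★★ **The target ⟺ the table law from `7` on** (`p = 5` settled by `tabAt_five`; `6` is not prime). -/
theorem target_iff_tabFrom7 :
    Summit.QuantumAdvantage.QuantumAdvantage.Theses.CharDial.FrobStructureLawOdd ↔ ∀ (p : ℕ) [Fact p.Prime], 7 ≤ p → TabAt p := by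
  rw [target_iff_tabOdd]
  constructor
  · intro h p _ hp
    exact h p (by omega)
  · intro h p hpi hp
    by_cases h5 : p = 5
    · subst h5
      exact tabAt_five
    · have h6 : p ≠ 6 := by
        rintro rfl
        exact absurd hpi.out (by decide)
      exact h p (by omega)

/-- THE RESIDUAL, typed: from `7` on, the sectors `γ ∉ {0, ±1, ±2}` of the dial with a uniform budget. -/
def SectorRes (p : ℕ) [Fact p.Prime] : Prop :=
  ∃ K : ℕ, ∀ L : ℕ, ∀ γ : ZMod p, γ ≠ 0 → γ ≠ 1 → γ ≠ -1 → γ ≠ 2 → γ ≠ -2 → TabLawAt p γ K L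

/-- Piece «Tab» ⟺ the residual sectors (every odd prime). -/
theorem tabAt_iff_sectorRes (p : ℕ) [hp : Fact p.Prime] (hp2 : p ≠ 2) : TabAt p ↔ SectorRes p := by
  rw [tabAt_iff_all]
  constructor
  · rintro ⟨K, hK⟩
    refine ⟨K, fun L γ hγ _ _ _ _ => ?_⟩
    exact (tabLaw_iff_sectors K L).1 (hK L) γ hγ
  · rintro ⟨K, hK⟩
    refine ⟨max K (p - 2), fun L => tabLaw_of_sectors p hp2 (le_max_right _ _) fun γ h0 h1 h1' h2 h2' => ?_⟩
    exact tabLawAt_mono_K (le_max_left _ _) (hK L γ h0 h1 h1' h2 h2')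

/-- ★★★ **The target ⟺ the residual sectors from `7` on.** -/
theorem target_iff_sectorResFrom7 :
    Summit.QuantumAdvantage.QuantumAdvantage.Theses.CharDial.FrobStructureLawOdd ↔
      ∀ (p : ℕ) [Fact p.Prime], 7 ≤ p → SectorRes p := by
  rw [target_iff_tabFrom7]
  constructor
  · intro h p _ hp
    exact (tabAt_iff_sectorRes p (by omega)).1 (h p hp)
  · intro h p _ hp
    exact (tabAt_iff_sectorRes p (by omega)).2 (h p hp)

/-- The first residual instance, `p = 7`: the sectors `γ = ±3` decide piece «Tab» at `7` (budget `max K 5`). -/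
theorem tabAt_seven_of_sector_three [Fact (Nat.Prime 7)] {K : ℕ} (h3 : ∀ L : ℕ, TabLawAt 7 3 K L) : TabAt 7 := by
  refine (tabAt_iff_sectorRes 7 (by norm_num)).2 ⟨K, fun L γ h0 h1 h1' h2 h2' => ?_⟩
  rcases units_seven γ h0 h1 h1' h2 h2' with rfl | rfl
  · exact h3 L
  · exact tabLawAt_neg (h3 L)

end Five

end Summit.QuantumAdvantage.QuantumAdvantage.Theorems.GammaDial
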